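import Literature.NumberTheory.EllipticCurves.IwasawaLeadingTerm
import Literature.NumberTheory.EllipticCurves.LeadingTerm
import Literature.NumberTheory.EllipticCurves.Tamagawa
import HarnessLib

/-!
# Kundu–Ray, *Statistics for Iwasawa invariants of elliptic curves, II* (Int. J. Number Theory
# 20 (2024) 1099–1124 = arXiv:2106.12095), Lemma 6.3 with Lemma 2.1:
# `λ_p + μ_p ≥ #{ℓ ≠ p : p ∣ c_ℓ(E)} + [p ∣ #Ẽ(𝔽_p)]` for `E/ℚ` good ordinary at odd `p`, `E(ℚ)[p] = 0`,
# `Ш(E/ℚ)[p^∞]` finite (named fact)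

HONEST FRAMING (BSD rank-`≤ 1` residual cell `b2b-bsdres`, home
`run/shared/lean/b2b/bsd-rank1-residual/`, unit `b2b-bsdres-eisenstein-p1`, gen 7): the cell deletes
the COMBINATION-SHAPED residual classes of the rank-`≤ 1` BSD formula from PUBLISHED theorems only
and TYPES the construction-shaped ones; this is not "finishing BSD". This file vendors ONE
published, numbered lemma as a named fact (`def … : Prop`, nothing asserted; D-0014/D-0026) plus
one vocabulary definition (`PDvdTamagawaAt`, "`p ∣ c_ℓ(E)`"). It is the PRINTED form of the
LAYER-0 case of the cell's route-T lower bound for `λ_alg` (HOME/b2b-bsdres-eisenstein-p1/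
X1R0-GAPMAP.md §14.1: `λ + p^m μ ≥ t_m + a − 2δ`; at `m = 0`, `δ = 0`: `t_0 = #{ℓ : p ∣ c_ℓ}`,
`a ≥ 1`), so far a TYPED input (`X1/TamagawaSqueeze.AlgebraicLambdaGE`): with this fact the route-T
closures at LAYER 0 of the leaf classes WITHOUT rational `p`-torsion (`φ ≠ 1`) become compositions
of published theorems (Kundu–Ray 6.3 + Greenberg Prop. 3.10 + Wuthrich Thm. 16 + Kato) with
certified integers; consumer `Summits/BirchSwinnertonDyer/Rank1Residual/X1/TamagawaSqueezeCited.lean`.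

## Citation header (read by this seat on the held copy)

* Authors: Debanjana Kundu, Anwesh Ray. Title: *Statistics for Iwasawa invariants of elliptic
  curves, II*. Venue: International Journal of Number Theory **20** (2024), no. 4, 1099–1124,
  doi:10.1142/s1793042124500556 (bib key `KunduRay2024`). REFEREED / PUBLISHED. Held copy: the
  arXiv version `paper:arxiv-2106.12095` (the journal PDF, acq-09079, was fulfilled by the hub with
  the arXiv text; numbering below is that of arXiv v2 (2023-10-30) = the ACCEPTED MANUSCRIPT, on which
  Lemma 2.1 / Def. 6.2 / Lemma 6.3 carry these numbers (LaTeX counters computed from the source; ARM P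
  reader sheet `D-AUDIT-r18-Q29-KunduRay2024.md` sha16 5c542fb3ea6c8285; the IJNT version of record itself
  unread — informational token `KR24-numbering-on-accepted-manuscript`).
* Standing hypotheses (§2 "Preliminaries", chunk p0005 L3–4): "Throughout, `p` will be a fixed odd
  prime number. Let `E/ℚ` be an elliptic curve with good ordinary reduction at `p`." The object
  (§2.1, chunk p0005): `Sel_{p^∞}(E/ℚ_∞)`, the `p`-primary Selmer group over the cyclotomic
  `ℤ_p`-extension `ℚ_∞ = ∪ ℚ_n` (defined with `J_ℓ(E/L) = ⊕_{w∣ℓ} H¹(L_w, E)[p^∞]`, i.e. the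
  CLASSICAL Selmer group), "Denote by `μ_p` (resp. `λ_p`) the `μ`-invariant (resp. `λ`-invariant) of
  the Selmer group `Sel_{p^∞}(E/ℚ_∞)`" (chunk p0005 L85–87; `μ_p(M) = Σ μ_i`, `λ_p(M) = Σ deg f_i` of
  the characteristic element of `M^∨`, L60–83), `g_p` = minimal number of generators of `Sel^∨`.
* **Lemma 2.1** (chunk p0005 L89–97), verbatim: "The following inequality holds `λ_p + μ_p ≥ g_p`.
  Proof. It follows from [greenberg1999iwasawa] that `Sel^∨` contains no non-zero finite
  `Λ`-submodules. The result then follows from [matsuno2007construction]."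
* **Definition 6.2** (chunk p0013 L60–71), verbatim: "Let `E/ℚ` be an elliptic curve with good
  ordinary reduction at the prime `p`. Define `𝔞_E^{(p)}` to be the number of primes `ℓ ≠ p` for
  which `p` divides the Tamagawa number `c_ℓ(E)`. Set `𝔟_E^{(p)} := 1` when `p ∣ #Ẽ(𝔽_p)`, `0`
  otherwise. Finally, write `𝔠_E^{(p)} := 𝔞_E^{(p)} + 𝔟_E^{(p)}`."
* **Lemma 6.3** (chunk p0013 L75–84), verbatim: "Let `E/ℚ` be an elliptic curve for which the
  following conditions are satisfied. • `E` has good ordinary reduction at `p`, • `E(ℚ)[p] = 0`,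
  • `Ш(E/ℚ)[p^∞]` is finite. Then, `g_p ≥ 𝔠_E^{(p)}`. In particular, `λ_p + μ_p ≥ 𝔠_E^{(p)}`."
  Proof (chunks p0013 L86 – p0014 L31): Cassels–Poitou–Tate (Lemma 6.1, `Ш[p^∞]` finite ⇒
  `coker Φ_{E,ℚ} ↪ (E(ℚ)^*)^∧`), the control diagram over `ℚ_∞/ℚ` with `g` an isomorphism since
  `E(ℚ)[p] = 0`, the snake lemma, and "It follows from [coates2000galois] that
  `dim_{𝔽_p}(ker h)[p] ≥ 𝔠_E^{(p)}`" (Coates–Sujatha, *Galois cohomology of elliptic curves*: the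
  local kernels at the Tamagawa primes and at the anomalous prime).

## Hypotheses, enumerated (word for word → tree predicate)

1. "`p` … odd prime", "`E/ℚ` … good ordinary reduction at `p`" — `p ≠ 2`,
   `W.HasGoodReductionAtPrime p`, `¬ (p : ℤ) ∣ W.frobeniusTrace p` (the cell's spelling of ordinary),
   `W : WeierstrassCurve ℚ`, `[W.IsElliptic]`, `[W.IsGloballyMinimal]`.
2. "`E(ℚ)[p] = 0`" — `#E(ℚ)[p^∞] = 1`, i.e.
   `Nat.card (AddCommGroup.primaryComponent W.toAffine.Point p) = 1` (the spelling of
   `IwasawaLeadingTerm.greenberg_charValue_rankZero`; equivalent since `E(ℚ)_tors` is finite).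
3. "`Ш(E/ℚ)[p^∞]` is finite" — `Finite W.sha` (a STRONGER hypothesis than print, hence a weaker
   fact; it is what Gross–Zagier–Kolyvagin supplies at analytic rank `≤ 1`,
   `LeadingTerm.rank_eq_analyticRank_of_analyticRank_le_one`).
4. `λ_p, μ_p` — for `κ : ZpExtension ℚ p` cyclotomic with topological generator `γ` and every
   Pontryagin-dual datum `D : W.SelmerDualData κ γ` (`D.X = Sel_{p^∞}(E/ℚ_∞)^∨`), finitely generated
   and `Λ`-torsion (Kato; an EXTRA hypothesis here, hence weaker than print): `lambdaInvariant p D.X`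
   and `D.mu = muInvariant p D.X` (`IwasawaAlgebra.lean`: `= Σ deg f_j`, `= Σ μ_i` by the structure
   theorem, `lambdaInvariant_eq_sum_natDegree_holds`, `muInvariant_eq_sum_holds` — Kundu–Ray's
   definitions L60–83).
5. `𝔞_E^{(p)}` — every finite set `S` of primes `ℓ ≠ p` with `p ∣ c_ℓ(E)` has `S.card ≤ 𝔞`; stated
   for all such `S` (`PDvdTamagawaAt W p ℓ`: `p ∣ (W/ℚ_ℓ).localTamagawaNumber ℤ_ℓ`, the tree's
   `c_ℓ = [E(ℚ_ℓ) : E₀(ℚ_ℓ)]` on the `ℤ_ℓ`-minimal model, `Tamagawa.lean`); `𝔟_E^{(p)}` —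
   `if p ∣ W.reductionPointCount p then 1 else 0` (`reductionPointCount W p = #Ẽ(𝔽_p)` at a good
   prime, `GlobalMinimalModel.lean`).
6. Conclusion "`λ_p + μ_p ≥ 𝔠_E^{(p)}`" — `S.card + 𝔟 ≤ lambdaInvariant p D.X + D.mu`.

No `_holds` soon (Cassels–Poitou–Tate over `ℚ`, the control diagram, the local kernels of
Coates–Sujatha, and Matsuno's generator inequality are not in Mathlib); consumers take
`(h : lem63_card_add_anomalous_le_lambda_add_mu)`. D-0026: exactly ONE named fact.

## References
* [KunduRay2024] D. Kundu, A. Ray, IJNT 20 (2024) 1099–1124, Lemma 2.1, Def. 6.2, Lemma 6.3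
  (arXiv:2106.12095 chunks p0005, p0013–p0014).
* K. Matsuno, Manuscripta Math. 122 (2007) 289–304 (the generator inequality; acq-07131).
* J. Coates, R. Sujatha, *Galois cohomology of elliptic curves*, TIFR/Narosa 2000 (local kernels).
* R. Greenberg, LNM 1716 (1999), Prop. 4.14/4.15 and Cor. 5.6 (the mechanism; `GreenbergLNM1716`).
* HOME/b2b-bsdres-eisenstein-p1/X1R0-GAPMAP.md §14 (route T), §16.9.
-/

set_option autoImplicit false

noncomputable section

open scoped Classical

open WeierstrassCurve Literature.NumberTheory.EllipticCurves

namespace Literature.NumberTheory.EllipticCurves.KunduRay2024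

/-- **"`p` divides the Tamagawa number `c_ℓ(E)`"** at a prime `ℓ` (Kundu–Ray Def. 6.2's `𝔞` counts
these `ℓ ≠ p`): `ℓ` is prime and `p ∣ [E(ℚ_ℓ) : E₀(ℚ_ℓ)]`, the tree's `localTamagawaNumber` of `W/ℚ_ℓ`
on its `ℤ_ℓ`-minimal model (`Tamagawa.lean`; `= c_ℓ` of Tate's algorithm).
[cite: KunduRay2024, Def. 6.2 (arXiv:2106.12095 §6.1)] -/
def PDvdTamagawaAt (W : WeierstrassCurve ℚ) (p ℓ : ℕ) : Prop :=
  ∃ _ : Fact ℓ.Prime, p ∣ (W.baseChange ℚ_[ℓ]).localTamagawaNumber ℤ_[ℓ]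

/-- **Kundu–Ray, IJNT 20 (2024), Lemma 6.3 (with Def. 6.2 and Lemma 2.1; arXiv:2106.12095 §6.1).**
"Let `E/ℚ` be an elliptic curve for which the following conditions are satisfied. • `E` has good
ordinary reduction at `p` [odd, §2], • `E(ℚ)[p] = 0`, • `Ш(E/ℚ)[p^∞]` is finite. Then,
`g_p ≥ 𝔠_E^{(p)}`. In particular, `λ_p + μ_p ≥ 𝔠_E^{(p)}`", where `𝔠 = 𝔞 + 𝔟`, "`𝔞_E^{(p)}` [is] the
number of primes `ℓ ≠ p` for which `p` divides the Tamagawa number `c_ℓ(E)`", "`𝔟_E^{(p)} := 1` when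
`p ∣ #Ẽ(𝔽_p)`, `0` otherwise", and `λ_p, μ_p` are the Iwasawa invariants of `Sel_{p^∞}(E/ℚ_∞)` over
the cyclotomic `ℤ_p`-extension. Transcription (module docstring items 1–6): `W/ℚ` globally minimal
elliptic, `p ≠ 2` good ordinary, `#E(ℚ)[p^∞] = 1`, `Ш(E/ℚ)` finite; for every finite set `S` of
primes `ℓ ≠ p` with `p ∣ c_ℓ(E)`, the cyclotomic `κ` with topological generator `γ`, and every
Pontryagin-dual datum `D` (finitely generated, `Λ`-torsion):
`S.card + [p ∣ #Ẽ(𝔽_p)] ≤ λ(D.X) + μ(D.X)`. Named fact; nothing asserted.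
-- TODO(general form): `Ш(E/ℚ)[p^∞]` finite (instead of `Ш` finite) and the intermediate `g_p ≥ 𝔠`.
-- Journal numbering: arXiv v2 (2023-10-30) = accepted manuscript — Lemma 2.1 / Def. 6.2 / Lemma 6.3 keep
-- these numbers (Lemma 2.1's proof cites Greenberg 1999 Prop. 4.15 and Matsuno 2007 Lemma 2.2; Lemma 6.3's
-- cites Coates–Sujatha p. 34 and Lemma 3.4 / Prop. 3.5); D-AUDIT-r18-Q29 5c542fb3ea6c8285 (VoR unread).
[cite: KunduRay2024, Lemma 6.3 with Def. 6.2 and Lemma 2.1 (IJNT 20 (2024) 1099–1124; arXiv:2106.12095 §2 chunk p0005, §6.1 chunks p0013–p0014)] -/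
def lem63_card_add_anomalous_le_lambda_add_mu : Prop :=
  ∀ (W : WeierstrassCurve ℚ) [W.IsElliptic] [W.IsGloballyMinimal] (p : ℕ) [Fact p.Prime],
    p ≠ 2 → W.HasGoodReductionAtPrime p → ¬ (p : ℤ) ∣ W.frobeniusTrace p →
    Nat.card (AddCommGroup.primaryComponent W.toAffine.Point p) = 1 → Finite W.sha →
    ∀ (S : Finset ℕ), (∀ ℓ ∈ S, ℓ ≠ p ∧ PDvdTamagawaAt W p ℓ) →
    ∀ (κ : ZpExtension ℚ p) (γ : Field.absoluteGaloisGroup ℚ),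
        κ.IsCyclotomic → κ.IsTopGenerator γ →
      ∀ (D : W.SelmerDualData κ γ) [Module.Finite (IwasawaAlgebra p) D.X], D.IsTorsion →
        S.card + (if p ∣ W.reductionPointCount p then 1 else 0) ≤ lambdaInvariant p D.X + D.mu

namespace lem63_card_add_anomalous_le_lambda_add_mu

/-- Lemma 6.3 projected at a member with `μ = 0` and an ANOMALOUS good ordinary `p`
(`p ∣ #Ẽ(𝔽_p)`): `#S + 1 ≤ λ(X(E/ℚ_∞))` for any set `S` of primes `ℓ ≠ p` with `p ∣ c_ℓ(E)` — the
layer-`0` route-T bound of the cell at the `φ ≠ 1` classes. [cite: KunduRay2024, Lemma 6.3] -/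
theorem card_succ_le_lambdaInvariant_of_mu_eq_zero
    (h : lem63_card_add_anomalous_le_lambda_add_mu)
    (W : WeierstrassCurve ℚ) [W.IsElliptic] [W.IsGloballyMinimal] (p : ℕ) [Fact p.Prime]
    (hp : p ≠ 2) (hgood : W.HasGoodReductionAtPrime p) (hord : ¬ (p : ℤ) ∣ W.frobeniusTrace p)
    (htors : Nat.card (AddCommGroup.primaryComponent W.toAffine.Point p) = 1) (hsha : Finite W.sha)
    (hanom : p ∣ W.reductionPointCount p)
    {S : Finset ℕ} (hS : ∀ ℓ ∈ S, ℓ ≠ p ∧ PDvdTamagawaAt W p ℓ)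
    {κ : ZpExtension ℚ p} {γ : Field.absoluteGaloisGroup ℚ}
    (hκ : κ.IsCyclotomic) (hγ : κ.IsTopGenerator γ) (D : W.SelmerDualData κ γ)
    [Module.Finite (IwasawaAlgebra p) D.X] (hD : D.IsTorsion) (hμ : D.mu = 0) :
    S.card + 1 ≤ lambdaInvariant p D.X := by
  have e := h W p hp hgood hord htors hsha S hS κ γ hκ hγ D hD
  rw [if_pos hanom, hμ, add_zero] at e
  exact e

end lem63_card_add_anomalous_le_lambda_add_mu

end Literature.NumberTheory.EllipticCurves.KunduRay2024

end
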